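/-
Copyright (c) 2026 the pub-hodgecm-mathlib formalisation cell (harness21).  Prover seat hodgecm-mathlib-F0P3a-p01 (g32), req620 Track A «(D-RAM) FOUR-FRAME» squad
(unit U3_Laws, (KMS) road «MODULO κ-STAGE B», brick κB-T tv = 2 TWIN «T-STRATA κ-SOCKETS, TYPE 2», FILE 3₂∕3₂: THE THREE TYPE-2 T-STRATA κ-SOCKETS;
dealer LH4-plan (g11) WORD #44 (1); head letters F0P3a-p01 (g32) 2026-09-04T02:00:51Z; type-0 template LH4-p04 (g2) `F0P3cDyRamDiagonalKappaSplitCountSockets`).  2026-09-04.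
-/
import Summits.HodgeConjecture.HodgeConjecture.Theorems.F0P3cDyRamDiagonalKappaSplitCountTwoValues   -- FILE 2₂ (this seat): `kappaCount_two_latt_axis1∕2∕3`; brings FILE 1₂, ★ κB-T FILE 1 (LH4-p04), ★ Fκ1∕Fκ2 (LH4-p05), ★ B4∕B4₂ (LH4-p13), ★ LocalFields
import Summits.HodgeConjecture.HodgeConjecture.Theorems.F0P3cDyRamDiagonalSplitCountTwoSockets     -- ★ B4₂ FILE 5 (LH4-p13): `finsum_stabiliserWeight_stratumTwo_T3∕T1∕T2` (the plain type-2 T-strata masses)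
import Summits.HodgeConjecture.HodgeConjecture.Theorems.F0P3cDyRamDiagonalKappaSplitCountSockets     -- ★ κB-T FILE 3 (LH4-p04): `cast_ite_mul_ite` (bookkeeping; the type-0 sockets)
import HarnessLib

/-!
# Crux `H413`, line LH4 «(D-RAM) FOUR-FRAME» road — unit U3_Laws (iii), (KMS) road «MODULO κ-STAGE B», brick κB-T tv = 2 TWIN, FILE 3₂∕3₂: THE TYPE-2 T-STRATA κ-SOCKETS —
# `Σᶠ_{M ∈ stratumTwo(a)} κ_i(M)·w(M) = ω(−1)·[i = foot]·[2d ≤ s + 1]·(★ B4₂ value)` on the three type-2 on-branch strata (`s` odd; no type-2 core)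

Cell `hodgecm-mathlib` (D-0151), FLOOR 0, crux item H413 = `stmt-HodgeConjecture-24833`, route of record `HCCMUnconditional`; squad F0∕P3c∕LH4 (req618∕req620); registered stub served:
`F0P3cDyRamFourFrameU3.stub_U3_kappaModelSum` (KMS; tree `Cruxes/H413/Lines/F0_P3c_DyRamFourFrame_U3_Laws.lean` ED. 8 :457), type-2 half — these are three of the per-stratum
inputs of the κ-Stage-B₂ sum `hBκ10₂` (`Σᶠ_{M ∈ 𝓛₀(T), type-2 polarisable} kappaCount σ ϖ 2 i M · stabiliserWeight σ M`, LH4-p05 (g3) Fκ5 — to be re-cut WITH `[CompleteSpace K]`,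
REF5 R5-96∕R5-97, dealer WORD #43 (1)).  THEOREMS ONLY (no `def`, no instance, no notation, no `sorry`, default heartbeats); lane `--supports stmt-HodgeConjecture-24833 --as helper`
(count-neutral).  Binders = ★ B4₂ `SplitCountTwoSockets` §Sockets VERBATIM + `[CompleteSpace K]` (the ALIVE window needs deep norms: head letter (A) 2026-09-04T01:25:48Z).

THE MATHEMATICS.  On `stratumTwo σ ϖ T (s,s,0)` every member is `M₃(s,x)` with `x` a unit (★ `hasAxis_axis3_iff`) and `s` odd (★ B4₂ `not_two_dvd_of_isTypeTwoPolarisable_latt_axis3`),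
and FILE 2₂ `kappaCount_two_latt_axis3` is CONSTANT there: `κ_i = ω(−1)·[i = 2]·[2d ≤ s + 1]`; so the κ-socket is that constant times the plain mass ★ `finsum_stabiliserWeight_stratumTwo_T3`
`= [s odd ∧ s ≤ n₃]·q^{s∕2}`.  Axes `(0,s,s)` (foot `0`, bound `n₁`) and `(s,0,s)` (foot `1`, bound `n₂`) likewise.  There is no type-2 core stratum to state.

* `finsum_kappaCount_two_mul_stabiliserWeight_stratumTwo_T3 ∕ _T1 ∕ _T2`.
HONEST LABEL.  Count-neutral (`--supports`); nothing printed is asserted; (KMS) stays a PROVER TARGET (empirical census law in diagonal-model currency); `HC_CM` is proved only modulo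
the 7 printed citations (2 remaining named inputs: hLiu418 = `stmt-HodgeConjecture-24832`, h413 = `stmt-HodgeConjecture-24833`) until rung 0 closes.

## References
* [Kottwitz1986BaseChangeUnits] R. E. Kottwitz, *Base change for unit elements of Hecke algebras*, Compositio Math. 60 (1986), §1 pp. 240–241.
* [Rogawski1990] J. D. Rogawski, *Automorphic Representations of Unitary Groups in Three Variables*, Ann. of Math. Stud. 123 (1990), §4.9 Prop. 4.9.1 (a) p. 55, §4.10 p. 58.
* [Serre1979] J.-P. Serre, *Local Fields*, GTM 67 (1979), Ch. V §3 Prop. 5, Cor. 3.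
-/

set_option autoImplicit false

noncomputable section

namespace Summit.HodgeConjecture.HodgeConjecture.Cruxes.H413.F0P3cDyRamDiagonalKappaSplitCountTwoSockets

open Matrix
open Literature.NumberTheory.Automorphic Literature.NumberTheory.Automorphic.HermitianLattice
open Literature.NumberTheory.Automorphic.UnitaryLatticeTree Literature.NumberTheory.Automorphic.UnitaryThreeFourFrame
open Literature.NumberTheory.LocalFields Literature.NumberTheory.LocalFields.WildQuadraticDatum
open Summit.HodgeConjecture.HodgeConjecture.Cruxes.H413.F0P3cDyRamDiagonalTorusDefs
open Summit.HodgeConjecture.HodgeConjecture.Cruxes.H413.F0P3cDyRamDiagonalStrataDefs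
open Summit.HodgeConjecture.HodgeConjecture.Cruxes.H413.F0P3cDyRamDiagonalKappaCountDefs
open Summit.HodgeConjecture.HodgeConjecture.Cruxes.H413.F0P3cDyRamDiagonalSplitCountTwo
open Summit.HodgeConjecture.HodgeConjecture.Cruxes.H413.F0P3cDyRamDiagonalSplitCountTwoAxisOne
open Summit.HodgeConjecture.HodgeConjecture.Cruxes.H413.F0P3cDyRamDiagonalSplitCountTwoAxisTwo
open Summit.HodgeConjecture.HodgeConjecture.Cruxes.H413.F0P3cDyRamDiagonalSplitCountSockets (hasAxis_axis3_iff hasAxis_axis1_iff hasAxis_axis2_iff)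
open Summit.HodgeConjecture.HodgeConjecture.Cruxes.H413.F0P3cDyRamDiagonalSplitCountTwoSockets
open Summit.HodgeConjecture.HodgeConjecture.Cruxes.H413.F0P3cDyRamDiagonalKappaSplitCountTwoValues
open Summit.HodgeConjecture.HodgeConjecture.Cruxes.H413.F0P3cDyRamDiagonalKappaSplitCountSockets (cast_ite_mul_ite)
open scoped Valued WithZero Matrix MatrixGroups

section Sockets

variable {K : Type} [Field K] [Valued K ℤᵐ⁰] [Fintype 𝓀[K]] [CompleteSpace K] {σ : K →+* K} {ϖ : K} {d t : ℕ} {α β : K} {N₀ n₁ n₂ n₃ : ℕ} {T : GL (Fin 3) K}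

/-- **TYPE-2 κ-SOCKET, AXIS `s, s, 0` (plane `⟨e₀,e₁⟩`, foot index `2`, depth letter `n₃`)**: `Σᶠ_{M ∈ stratumTwo s, s, 0} κ_i(M)·w(M) = ω(−1)·q^{s∕2}` if `i = 2`,
`2d ≤ s + 1`, `s` odd, `s ≤ n₃`, and `0` otherwise (FILE 2₂ `kappaCount_two_latt_axis3` is constant on the stratum; ★ B4₂ `finsum_stabiliserWeight_stratumTwo_T3`).
[cite: Kottwitz1986BaseChangeUnits, §1 pp. 240–241] [cite: Rogawski1990, §4.9 Prop. 4.9.1 (a) p. 55] [cite: Serre1979, Ch. V §3 Prop. 5, Cor. 3] -/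
theorem finsum_kappaCount_two_mul_stabiliserWeight_stratumTwo_T3 (hD : IsRamifiedQuadraticDatum σ ϖ d t) (hE : IsElementDatum σ ϖ N₀ α β n₁ n₂ n₃)
    (hT : (T : Matrix (Fin 3) (Fin 3) K) = Matrix.diagonal ![α, β, 1]) (s : ℕ) (hs : 1 ≤ s) (i : Fin 3) :
    ∑ᶠ M ∈ stratumTwo σ ϖ T ![s, s, 0], (kappaCount σ ϖ 2 i M : ℚ) * stabiliserWeight σ M =
      if i = 2 ∧ 2 * d ≤ s + 1 ∧ ¬ 2 ∣ s ∧ s ≤ n₃ then (normSign σ (-1 : K) : ℚ) * (Fintype.card 𝓀[K] : ℚ) ^ (s / 2) else 0 := by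
  have hD' := hD
  obtain ⟨-, hvσ, hϖ, hfix, -, -, -⟩ := hD'
  have hκ : ∀ M ∈ stratumTwo σ ϖ T ![s, s, 0], (kappaCount σ ϖ 2 i M : ℚ) * stabiliserWeight σ M =
      ((if i = 2 ∧ 2 * d ≤ s + 1 then normSign σ (-1 : K) else 0 : ℤ) : ℚ) * stabiliserWeight σ M := by
    rintro M ⟨hM, hpol, hax⟩
    obtain ⟨x, hx, rfl⟩ := (hasAxis_axis3_iff hϖ hM hs).1 hax
    rw [kappaCount_two_latt_axis3 hD hx (not_two_dvd_of_isTypeTwoPolarisable_latt_axis3 hvσ hfix hϖ hx hpol) i]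
  rw [finsum_mem_congr rfl hκ, ← mul_finsum_mem, finsum_stabiliserWeight_stratumTwo_T3 hD hE hT s hs, cast_ite_mul_ite]
  simp only [and_assoc]

/-- **TYPE-2 κ-SOCKET, AXIS `0, s, s` (plane `⟨e₁,e₂⟩`, foot index `0`, depth letter `n₁`)**: `Σᶠ_{M ∈ stratumTwo 0, s, s} κ_i(M)·w(M) = ω(−1)·q^{s∕2}` if `i = 0`,
`2d ≤ s + 1`, `s` odd, `s ≤ n₁`, and `0` otherwise (FILE 2₂ `kappaCount_two_latt_axis1` is constant on the stratum; ★ B4₂ `finsum_stabiliserWeight_stratumTwo_T1`).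
[cite: Kottwitz1986BaseChangeUnits, §1 pp. 240–241] [cite: Rogawski1990, §4.9 Prop. 4.9.1 (a) p. 55] [cite: Serre1979, Ch. V §3 Prop. 5, Cor. 3] -/
theorem finsum_kappaCount_two_mul_stabiliserWeight_stratumTwo_T1 (hD : IsRamifiedQuadraticDatum σ ϖ d t) (hE : IsElementDatum σ ϖ N₀ α β n₁ n₂ n₃)
    (hT : (T : Matrix (Fin 3) (Fin 3) K) = Matrix.diagonal ![α, β, 1]) (s : ℕ) (hs : 1 ≤ s) (i : Fin 3) :
    ∑ᶠ M ∈ stratumTwo σ ϖ T ![0, s, s], (kappaCount σ ϖ 2 i M : ℚ) * stabiliserWeight σ M =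
      if i = 0 ∧ 2 * d ≤ s + 1 ∧ ¬ 2 ∣ s ∧ s ≤ n₁ then (normSign σ (-1 : K) : ℚ) * (Fintype.card 𝓀[K] : ℚ) ^ (s / 2) else 0 := by
  have hD' := hD
  obtain ⟨-, hvσ, hϖ, hfix, -, -, -⟩ := hD'
  have hκ : ∀ M ∈ stratumTwo σ ϖ T ![0, s, s], (kappaCount σ ϖ 2 i M : ℚ) * stabiliserWeight σ M =
      ((if i = 0 ∧ 2 * d ≤ s + 1 then normSign σ (-1 : K) else 0 : ℤ) : ℚ) * stabiliserWeight σ M := by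
    rintro M ⟨hM, hpol, hax⟩
    obtain ⟨z, hz, rfl⟩ := (hasAxis_axis1_iff hϖ hM hs).1 hax
    rw [kappaCount_two_latt_axis1 hD hz (not_two_dvd_of_isTypeTwoPolarisable_latt_axis1 hvσ hfix hϖ hz hpol) i]
  rw [finsum_mem_congr rfl hκ, ← mul_finsum_mem, finsum_stabiliserWeight_stratumTwo_T1 hD hE hT s hs, cast_ite_mul_ite]
  simp only [and_assoc]

/-- **TYPE-2 κ-SOCKET, AXIS `s, 0, s` (plane `⟨e₀,e₂⟩`, foot index `1`, depth letter `n₂`)**: `Σᶠ_{M ∈ stratumTwo s, 0, s} κ_i(M)·w(M) = ω(−1)·q^{s∕2}` if `i = 1`,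
`2d ≤ s + 1`, `s` odd, `s ≤ n₂`, and `0` otherwise (FILE 2₂ `kappaCount_two_latt_axis2` is constant on the stratum; ★ B4₂ `finsum_stabiliserWeight_stratumTwo_T2`).
[cite: Kottwitz1986BaseChangeUnits, §1 pp. 240–241] [cite: Rogawski1990, §4.9 Prop. 4.9.1 (a) p. 55] [cite: Serre1979, Ch. V §3 Prop. 5, Cor. 3] -/
theorem finsum_kappaCount_two_mul_stabiliserWeight_stratumTwo_T2 (hD : IsRamifiedQuadraticDatum σ ϖ d t) (hE : IsElementDatum σ ϖ N₀ α β n₁ n₂ n₃)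
    (hT : (T : Matrix (Fin 3) (Fin 3) K) = Matrix.diagonal ![α, β, 1]) (s : ℕ) (hs : 1 ≤ s) (i : Fin 3) :
    ∑ᶠ M ∈ stratumTwo σ ϖ T ![s, 0, s], (kappaCount σ ϖ 2 i M : ℚ) * stabiliserWeight σ M =
      if i = 1 ∧ 2 * d ≤ s + 1 ∧ ¬ 2 ∣ s ∧ s ≤ n₂ then (normSign σ (-1 : K) : ℚ) * (Fintype.card 𝓀[K] : ℚ) ^ (s / 2) else 0 := by
  have hD' := hD
  obtain ⟨-, hvσ, hϖ, hfix, -, -, -⟩ := hD'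
  have hκ : ∀ M ∈ stratumTwo σ ϖ T ![s, 0, s], (kappaCount σ ϖ 2 i M : ℚ) * stabiliserWeight σ M =
      ((if i = 1 ∧ 2 * d ≤ s + 1 then normSign σ (-1 : K) else 0 : ℤ) : ℚ) * stabiliserWeight σ M := by
    rintro M ⟨hM, hpol, hax⟩
    obtain ⟨y, hy, rfl⟩ := (hasAxis_axis2_iff hϖ hM hs).1 hax
    rw [kappaCount_two_latt_axis2 hD hy (not_two_dvd_of_isTypeTwoPolarisable_latt_axis2 hvσ hfix hϖ hy hpol) i]
  rw [finsum_mem_congr rfl hκ, ← mul_finsum_mem, finsum_stabiliserWeight_stratumTwo_T2 hD hE hT s hs, cast_ite_mul_ite]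
  simp only [and_assoc]

end Sockets

end Summit.HodgeConjecture.HodgeConjecture.Cruxes.H413.F0P3cDyRamDiagonalKappaSplitCountTwoSockets

end
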